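import Mathlib
import HarnessLib
import Summits.NavierStokesRegularity.NavierStokesRegularity.Theorems.PoloidalWindowDoorLrcModEntireSheetFlattenTools

/-!
# Route `PoloidalWindowDoor`, item `LrcModEntire` (stmt-NavierStokesRegularity-20428), cell (Q4-line) — GENERIC CALCULUS TOOLS of the closer

Cell ns-regularity-ideate, LEAD-lineage seat ns-poloidal-K2-p3 g16 (`--supports stmt-NavierStokesRegularity-20428`; memo `Cruxes/LrcModEntire/T2B-g16.md`).
Class-free one-variable / three-variable calculus used by `…Q4LineCore.q4line_core`:
* `fderiv_fderiv_eq_zero_of_const_on_line` — `s ↦ F(s·e)` constant ⇒ `D²F(0)[e][e] = 0`;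
* `affine_of_deriv_deriv_eq_zero` — `f″ = 0` on an open preconnected set ⇒ `f` affine there;
* `affine_on_window_of_deriv_deriv_eq_zero` — a `C^ω` function on `|z| < δ` with `f″ = 0` near `0` is affine on `|z| < δ` (identity theorem);
* `nested_const_mul`, `fderiv_two_horizontal_eq_zero` — bookkeeping (`σ·θ`, horizontal directional derivatives of `u₂`);
* `fderiv_apply_eq_zero_of_slab` — an analytic `θ` with `∂_eθ = 0` on an open slab `{x₂ ∈ J}` has `∂_eθ ≡ 0` (identity theorem on `ℝ³`).

WHAT THIS IS NOT: not a claim about Navier–Stokes regularity; calculus (bears_on LADDER-NS N0 via item 20428).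
-/

noncomputable section

set_option linter.dupNamespace false
set_option linter.unusedVariables false

namespace Summit.NavierStokesRegularity.NavierStokesRegularity.Theorems.PoloidalWindowDoorLrcModEntireQ4LineTools

open Set Function Filter Topology Metric
open scoped RealInnerProductSpace InnerProductSpace Laplacian ContDiff
open Summit.NavierStokesRegularity.NavierStokesRegularity.Theorems.PoloidalWindowDoorLrcModEntireSheetCauchyUniqueness
open Summit.NavierStokesRegularity.NavierStokesRegularity.Theorems.PoloidalWindowDoorLrcModEntireSheetFlattenTools

/-! ### Generic calculus helpers -/

/-- If `s ↦ F(s·e)` is constant then `D²F(0)[e][e] = 0`. -/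
theorem fderiv_fderiv_eq_zero_of_const_on_line {F : EuclideanSpace ℝ (Fin 3) → ℝ} (hF : ContDiff ℝ 2 F)
    (e : EuclideanSpace ℝ (Fin 3)) {c : ℝ} (h : ∀ s : ℝ, F (s • e) = c) :
    fderiv ℝ (fderiv ℝ F) 0 e e = 0 := by
  have hFd : Differentiable ℝ F := hF.differentiable (by norm_num)
  have hD : Differentiable ℝ (fderiv ℝ F) := (hF.fderiv_right (m := 1) (by norm_num)).differentiable (by norm_num)
  have hl : ∀ s : ℝ, HasDerivAt (fun s : ℝ => s • e) e s := fun s => by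
    simpa using (hasDerivAt_id s).smul_const e
  -- first derivative along the line vanishes
  have h1 : ∀ s : ℝ, fderiv ℝ F (s • e) e = 0 := fun s => by
    have hc := ((hFd (s • e)).hasFDerivAt.comp_hasDerivAt s (hl s)).deriv
    have hconst : deriv (fun s : ℝ => F (s • e)) s = 0 := by
      rw [show (fun s : ℝ => F (s • e)) = fun _ => c from funext h, deriv_const]
    have e1 : (F ∘ fun s : ℝ => s • e) = fun s : ℝ => F (s • e) := rfl
    rw [e1, hconst] at hc
    exact hc.symm
  -- differentiate once more at `s = 0`
  have h2 : HasDerivAt (fun s : ℝ => fderiv ℝ F (s • e) e) (fderiv ℝ (fderiv ℝ F) ((0 : ℝ) • e) e e) 0 := by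
    have hc := (hD ((0 : ℝ) • e)).hasFDerivAt.comp_hasDerivAt (0 : ℝ) (hl 0)
    have hc' : HasDerivAt (fun s : ℝ => fderiv ℝ F (s • e)) (fderiv ℝ (fderiv ℝ F) ((0 : ℝ) • e) e) 0 := hc
    simpa using hc'.clm_apply (hasDerivAt_const (0 : ℝ) e)
  have h3 : deriv (fun s : ℝ => fderiv ℝ F (s • e) e) 0 = 0 := by
    rw [show (fun s : ℝ => fderiv ℝ F (s • e) e) = fun _ => (0 : ℝ) from funext h1, deriv_const]
  rw [h2.deriv, zero_smul] at h3
  exact h3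

/-- A function with vanishing second derivative on an open preconnected set is affine there. -/
theorem affine_of_deriv_deriv_eq_zero {f : ℝ → ℝ} {s : Set ℝ} (hs : IsOpen s) (hs' : IsPreconnected s)
    (hf : ∀ z ∈ s, DifferentiableAt ℝ f z) (hf' : ∀ z ∈ s, DifferentiableAt ℝ (deriv f) z)
    (h : ∀ z ∈ s, deriv (deriv f) z = 0) {c : ℝ} (hc : c ∈ s) :
    ∀ z ∈ s, f z = f c + deriv f c * (z - c) := by
  have hb : ∀ z ∈ s, deriv f z = deriv f c := fun z hz =>
    hs.is_const_of_deriv_eq_zero hs' (fun w hw => (hf' w hw).differentiableWithinAt) (fun w hw => h w hw) hz hc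
  set g : ℝ → ℝ := fun z => f z - deriv f c * z with hg
  have hgd : ∀ z ∈ s, HasDerivAt g (deriv f z - deriv f c * 1) z := fun z hz =>
    (hf z hz).hasDerivAt.sub ((hasDerivAt_id z).const_mul (deriv f c))
  have hg0 : ∀ z ∈ s, deriv g z = 0 := fun z hz => by rw [(hgd z hz).deriv, hb z hz]; ring
  intro z hz
  have hconst := hs.is_const_of_deriv_eq_zero hs' (fun w hw => (hgd w hw).differentiableAt.differentiableWithinAt)
    (fun w hw => hg0 w hw) hz hc
  simp only [hg] at hconst
  linarith

/-- Nested second derivatives of `σ·θ`. -/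
theorem nested_const_mul {θ : EuclideanSpace ℝ (Fin 3) → ℝ} (hθ : ContDiff ℝ 2 θ) (σ : ℝ) (x a b : EuclideanSpace ℝ (Fin 3)) :
    fderiv ℝ (fun w => fderiv ℝ (fun y => σ * θ y) w b) x a = σ * fderiv ℝ (fun w => fderiv ℝ θ w b) x a := by
  have hθd : Differentiable ℝ θ := hθ.differentiable (by norm_num)
  have hD : Differentiable ℝ (fderiv ℝ θ) := (hθ.fderiv_right (m := 1) (by norm_num)).differentiable (by norm_num)
  have h1 : (fun w => fderiv ℝ (fun y => σ * θ y) w b) = fun w => σ * fderiv ℝ θ w b := by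
    funext w; rw [fderiv_const_mul (hθd w)]; simp
  rw [h1, fderiv_const_mul ((hD x).clm_apply (differentiableAt_const b))]
  simp

/-- A horizontal directional derivative of `u₂` vanishes where `∂₀u₂ = ∂₁u₂ = 0`. -/
theorem fderiv_two_horizontal_eq_zero {u : EuclideanSpace ℝ (Fin 3) → EuclideanSpace ℝ (Fin 3)} {x : EuclideanSpace ℝ (Fin 3)}
    (hu : DifferentiableAt ℝ u x) (h0 : fderiv ℝ u x (EuclideanSpace.single 0 1) 2 = 0)
    (h1 : fderiv ℝ u x (EuclideanSpace.single 1 1) 2 = 0) {w : EuclideanSpace ℝ (Fin 3)} (hw : w 2 = 0) :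
    fderiv ℝ (fun y => u y 2) x w = 0 := by
  have hc := ((EuclideanSpace.proj (𝕜 := ℝ) (2 : Fin 3)).hasFDerivAt).comp x hu.hasFDerivAt
  rw [show (fun y => u y 2) = (EuclideanSpace.proj (𝕜 := ℝ) (2 : Fin 3)) ∘ u from rfl, hc.fderiv,
    ContinuousLinearMap.comp_apply, horizontal_decomp hw, map_add, map_smul, map_smul]
  simp [h0, h1]

/-- A function `C^ω` on the window `|z| < δ` whose second derivative vanishes on `(−δ₁, δ₁)` (`0 < δ₁ ≤ δ`) is affine on the whole window. -/
theorem affine_on_window_of_deriv_deriv_eq_zero {f : ℝ → ℝ} {δ δ₁ : ℝ} (hδ₁ : 0 < δ₁) (hδ₁δ : δ₁ ≤ δ)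
    (hf : ∀ z : ℝ, |z| < δ → ContDiffAt ℝ ω f z) (h : ∀ z ∈ Ioo (-δ₁) δ₁, deriv (deriv f) z = 0) :
    ∃ a b : ℝ, ∀ z : ℝ, |z| < δ → f z = a + b * z := by
  have habs : ∀ z : ℝ, z ∈ Ioo (-δ) δ ↔ |z| < δ := fun z => by rw [mem_Ioo, abs_lt]
  have hIδ : Ioo (-δ₁) δ₁ ⊆ Ioo (-δ) δ := fun z hz => ⟨by linarith [hz.1], by linarith [hz.2]⟩
  have hfon : ContDiffOn ℝ ω f (Ioo (-δ) δ) := fun z hz => (hf z ((habs z).1 hz)).contDiffWithinAt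
  have hf1on : ContDiffOn ℝ 2 (deriv f) (Ioo (-δ) δ) :=
    ((contDiffOn_succ_iff_deriv_of_isOpen isOpen_Ioo).1 (hfon.of_le (m := 2 + 1) le_top)).2.2
  have hfd : ∀ z ∈ Ioo (-δ) δ, DifferentiableAt ℝ f z := fun z hz => (hf z ((habs z).1 hz)).differentiableAt (by simp)
  have hf'd : ∀ z ∈ Ioo (-δ) δ, DifferentiableAt ℝ (deriv f) z := fun z hz =>
    ((hf1on.differentiableOn (by norm_num)) z hz).differentiableAt (isOpen_Ioo.mem_nhds hz)
  have h0mem : (0 : ℝ) ∈ Ioo (-δ₁) δ₁ := ⟨by linarith, hδ₁⟩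
  have h0δ : (0 : ℝ) ∈ Ioo (-δ) δ := hIδ h0mem
  have haff := affine_of_deriv_deriv_eq_zero isOpen_Ioo isPreconnected_Ioo (fun z hz => hfd z (hIδ hz))
    (fun z hz => hf'd z (hIδ hz)) h h0mem
  set a : ℝ := f 0 with ha
  set b : ℝ := deriv f 0 with hb
  have han : AnalyticOnNhd ℝ (fun z => f z - (a + b * z)) (Ioo (-δ) δ) := fun z hz =>
    ((hf z ((habs z).1 hz)).analyticAt).sub (analyticAt_const.add (analyticAt_const.mul analyticAt_id))
  have hev0 : (fun z => f z - (a + b * z)) =ᶠ[𝓝 (0 : ℝ)] 0 := by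
    filter_upwards [isOpen_Ioo.mem_nhds h0mem] with z hz
    rw [haff z hz]; simp
  have hzero := han.eqOn_zero_of_preconnected_of_eventuallyEq_zero isPreconnected_Ioo h0δ hev0
  refine ⟨a, b, fun z hz => ?_⟩
  have h := hzero ((habs z).2 hz)
  simp only [Pi.zero_apply] at h
  linarith

/-- **Identity theorem on a slab.**  An analytic `θ : ℝ³ → ℝ` with `∂_eθ = 0` on the open slab `{x | x₂ ∈ J}` (`J` open, nonempty) has `∂_eθ ≡ 0`. -/
theorem fderiv_apply_eq_zero_of_slab {θ : EuclideanSpace ℝ (Fin 3) → ℝ} (hθ : AnalyticOnNhd ℝ θ univ) {J : Set ℝ} (hJ : IsOpen J)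
    {z₀ : ℝ} (hz₀ : z₀ ∈ J) (e : EuclideanSpace ℝ (Fin 3)) (h : ∀ x : EuclideanSpace ℝ (Fin 3), x 2 ∈ J → fderiv ℝ θ x e = 0) :
    ∀ x : EuclideanSpace ℝ (Fin 3), fderiv ℝ θ x e = 0 := by
  have han : AnalyticOnNhd ℝ (⇑(ContinuousLinearMap.apply ℝ ℝ e) ∘ fderiv ℝ θ) univ :=
    fun x hx => ((ContinuousLinearMap.apply ℝ ℝ e).analyticAt _).comp (hθ.fderiv x hx)
  have hSo : IsOpen ((EuclideanSpace.proj (𝕜 := ℝ) (2 : Fin 3)) ⁻¹' J) :=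
    hJ.preimage (EuclideanSpace.proj (𝕜 := ℝ) (2 : Fin 3)).continuous
  have hx₀ : (z₀ • e2) ∈ ((EuclideanSpace.proj (𝕜 := ℝ) (2 : Fin 3)) ⁻¹' J) := by
    show (z₀ • e2) 2 ∈ J
    simpa [e2] using hz₀
  have hev : (⇑(ContinuousLinearMap.apply ℝ ℝ e) ∘ fderiv ℝ θ) =ᶠ[𝓝 (z₀ • e2)] 0 := by
    filter_upwards [hSo.mem_nhds hx₀] with x hx
    simp only [Function.comp_apply, ContinuousLinearMap.apply_apply, Pi.zero_apply]
    exact h x hx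
  have hall := han.eqOn_zero_of_preconnected_of_eventuallyEq_zero isPreconnected_univ (mem_univ _) hev
  intro x
  have hx := hall (mem_univ x)
  simpa only [Function.comp_apply, ContinuousLinearMap.apply_apply, Pi.zero_apply] using hx

end Summit.NavierStokesRegularity.NavierStokesRegularity.Theorems.PoloidalWindowDoorLrcModEntireQ4LineTools

end
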